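import Summits.ABC.ABC.Theorems.YuMatveevShapeRatCloses
import HarnessLib

/-!
# The LFL input of the few-prime valuation-product line is UNCONDITIONAL (by the rung F-A1.L)

`Summits/ABC/ABC/Theorems/FewPrimeValuationProductLflInput.lean` — cell `abc-stewartyu` (plan g12 2026-08-27T23:37:51Z; seat p2 g8).  The crux
`FewPrimeValuationProduct` (stmt-ABC-1563) of route `RibetTakahashiSplit`, line `matveev_face_clearing`
(`Summits/ABC/ABC/Cruxes/FewPrimeValuationProduct/Lines/matveev_face_clearing.lean`), carries the registered stub
`stub_lflInput : ∃ K : ℝ, 1 ≤ K ∧ Dioph.PastenApproximationBound K` — so far only conditionally discharged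
(`Summit.ABC.ABC.Theorems.stub_lflInput_of_evertseGyory`, from the named fact `Dioph.evertseGyory_thm_4_2_1_rat`), and five further
registered stubs of that item take the same statement as a hypothesis.  That statement is `Dioph.approximationBound_rat` unfolded, which is
the kernel theorem `Summit.ABC.ABC.Theorems.approximationBound_rat_holds` (rung F-A1.L of route `YuMatveevShapeRat`, ✓ p584875, route
CLOSED·proved 2026-08-27T23:30Z).  PROOFS ONLY; the stub bookkeeping (skeleton re-check of `matveev_face_clearing`) belongs to that route's lead.
WHAT THIS IS NOT: any motion on the hard core `stub_hardCore` of that line (abc/Pillai strength, open); an abc claim.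
-/

-- `Summit.<Summit>.<Problem>` is the mandated summit-side namespace (CONVENTIONS §2); for the single-conjunct summit `ABC` the two
-- coincide, so the duplicate `ABC.ABC` is deliberate.
set_option linter.dupNamespace false

namespace Summit.ABC.ABC.Theorems

open Literature.NumberTheory.DiophantineGeometry

/-- **The LFL input of line `matveev_face_clearing` (stub `stub_lflInput` of stmt-ABC-1563), unconditionally**: `∃ K ≥ 1` with Pasten's
approximation bound `PastenApproximationBound K` over `ℚ` (both places) — the rung F-A1.L by name.
[cite: Pasten2024, Theorem 2.1 (d = 1)] [cite: EvertseGyory2015, Thm 4.2.1 (p. 68), K = ℚ, α = 1] -/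
theorem stub_lflInput : ∃ K : ℝ, 1 ≤ K ∧ Literature.NumberTheory.DiophantineGeometry.Dioph.PastenApproximationBound K :=
  approximationBound_rat_holds

end Summit.ABC.ABC.Theorems
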